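import Mathlib.MeasureTheory.Function.ConvergenceInMeasure
import Mathlib.MeasureTheory.Integral.IntervalIntegral.Basic
import Mathlib.MeasureTheory.Integral.DominatedConvergence
import Literature.Analysis.FunctionSpaces.SobolevCompleteness
import HarnessLib

/-!
# `L¹` limits from a Cauchy modulus, almost-everywhere subsequences, and limits of
# one-dimensional "slice data"

(namespace `Literature.Analysis.FunctionSpaces`)

Elementary real-analysis packaging used when passing to the limit along minimising sequences:

* `exists_integrable_tendsto_of_cauchy_modulus` : if `∫ |fₖ - fₗ| ≤ βₖ + βₗ` with `β → 0` then the
  `fₖ` converge in `L¹(μ)` to an integrable `g` (Riesz–Fischer, via Mathlib's complete `Lp`);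
* `exists_subseq_ae_tendsto_of_L1` : an `L¹(μ)`-convergent sequence has an a.e. convergent
  subsequence;
* `exists_sliceData_limits` : for sequences of one-dimensional data `(Mₖ, Pₖ, ETₖ, Eₖ)` on `[0, L]`
  with `Mₖ = ∫₀ Pₖ`, `Pₖ² ≤ 4 Mₖ ETₖ`, `0 ≤ ETₖ ≤ Eₖ` a.e. and `L¹` Cauchy moduli, the `L¹` limits
  `(m, p, et, e)` exist, `m = ∫₀ p` is continuous, `Mₖ → m` uniformly, and the pointwise / a.e.
  relations pass to the limit.

All folklore. [folklore]
-/

noncomputable section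

open MeasureTheory TopologicalSpace Filter Set Metric Function intervalIntegral
open scoped ENNReal NNReal Topology

namespace Literature.Analysis.FunctionSpaces

section L1

variable {α : Type*} [MeasurableSpace α] {μ : Measure α}

/-- For an integrable real function, `eLpNorm f 1 μ = ofReal (∫ |f|)`. [folklore] -/
theorem eLpNorm_one_eq_ofReal_integral_abs {f : α → ℝ} (hf : Integrable f μ) :
    eLpNorm f 1 μ = ENNReal.ofReal (∫ x, |f x| ∂μ) := by
  rw [eLpNorm_one_eq_lintegral_enorm, ← ofReal_integral_norm_eq_lintegral_enorm hf]
  simp only [Real.norm_eq_abs]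

/-- **`L¹` limit from a Cauchy modulus.** If `∫ |fₖ - fₗ| dμ ≤ βₖ + βₗ` for all `k, l` with
`βₖ → 0`, then there is an integrable `g` with `∫ |fₖ - g| dμ → 0`. [folklore] -/
theorem exists_integrable_tendsto_of_cauchy_modulus (f : ℕ → α → ℝ) (hf : ∀ k, Integrable (f k) μ)
    (β : ℕ → ℝ) (hβ : Tendsto β atTop (𝓝 0))
    (hC : ∀ k l, ∫ x, |f k x - f l x| ∂μ ≤ β k + β l) :
    ∃ g : α → ℝ, Integrable g μ ∧ Tendsto (fun k => ∫ x, |f k x - g x| ∂μ) atTop (𝓝 0) := by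
  have hmem : ∀ k, MemLp (f k) 1 μ := fun k => memLp_one_iff_integrable.2 (hf k)
  have hCe : ∀ ε : ℝ≥0∞, 0 < ε → ∃ N, ∀ n ≥ N, ∀ m ≥ N, eLpNorm (f n - f m) 1 μ < ε := by
    intro ε hε
    -- choose a real `η > 0` with `ofReal (2η) ≤ ε`... work with `β k < η`
    obtain ⟨η, hη0, hηε⟩ : ∃ η : ℝ, 0 < η ∧ ENNReal.ofReal (2 * η) < ε := by
      rcases eq_or_ne ε ⊤ with h | h
      · exact ⟨1, one_pos, h ▸ ENNReal.ofReal_lt_top⟩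
      · refine ⟨ε.toReal / 4, by
          have := ENNReal.toReal_pos hε.ne' h; linarith, ?_⟩
        rw [show 2 * (ε.toReal / 4) = ε.toReal / 2 by ring]
        calc ENNReal.ofReal (ε.toReal / 2) < ENNReal.ofReal ε.toReal := by
              rw [ENNReal.ofReal_lt_ofReal_iff_of_nonneg (by positivity)]
              have := ENNReal.toReal_pos hε.ne' h; linarith
          _ = ε := ENNReal.ofReal_toReal h
    obtain ⟨N, hN⟩ := (Metric.tendsto_atTop.1 hβ) η hη0
    refine ⟨N, fun n hn m hm => ?_⟩
    have hβn : β n < η := by have := hN n hn; rw [Real.dist_eq, sub_zero] at this; exact (abs_lt.1 this).2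
    have hβm : β m < η := by have := hN m hm; rw [Real.dist_eq, sub_zero] at this; exact (abs_lt.1 this).2
    rw [eLpNorm_one_eq_ofReal_integral_abs ((hf n).sub (hf m))]
    refine lt_of_le_of_lt ?_ hηε
    refine ENNReal.ofReal_le_ofReal ?_
    have := hC n m
    simp only [Pi.sub_apply]
    linarith
  obtain ⟨g, hg, hlim⟩ := exists_memLp_tendsto_of_cauchy le_rfl hmem hCe
  have hgi : Integrable g μ := memLp_one_iff_integrable.1 hg
  refine ⟨g, hgi, ?_⟩
  have hlim' : Tendsto (fun k => (eLpNorm (f k - g) 1 μ).toReal) atTop (𝓝 0) := by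
    have := (ENNReal.tendsto_toReal ENNReal.zero_ne_top).comp hlim
    rw [ENNReal.toReal_zero] at this
    exact this
  refine hlim'.congr fun k => ?_
  rw [eLpNorm_one_eq_ofReal_integral_abs ((hf k).sub hgi), ENNReal.toReal_ofReal
    (integral_nonneg fun x => abs_nonneg _)]
  simp only [Pi.sub_apply]

/-- **An `L¹`-convergent sequence has an a.e. convergent subsequence.** [folklore] -/
theorem exists_subseq_ae_tendsto_of_L1 (f : ℕ → α → ℝ) (g : α → ℝ) (hf : ∀ k, Integrable (f k) μ)
    (hg : Integrable g μ) (h : Tendsto (fun k => ∫ x, |f k x - g x| ∂μ) atTop (𝓝 0)) :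
    ∃ ns : ℕ → ℕ, StrictMono ns ∧ ∀ᵐ x ∂μ, Tendsto (fun j => f (ns j) x) atTop (𝓝 (g x)) := by
  have hT : Tendsto (fun k => eLpNorm (f k - g) 1 μ) atTop (𝓝 0) := by
    have h' : Tendsto (fun k => ENNReal.ofReal (∫ x, |f k x - g x| ∂μ)) atTop (𝓝 (ENNReal.ofReal 0)) :=
      (ENNReal.continuous_ofReal.tendsto 0).comp h
    rw [ENNReal.ofReal_zero] at h'
    refine h'.congr fun k => ?_
    rw [eLpNorm_one_eq_ofReal_integral_abs ((hf k).sub hg)]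
    simp only [Pi.sub_apply]
  exact (tendstoInMeasure_of_tendsto_eLpNorm one_ne_zero (fun k => (hf k).aestronglyMeasurable)
    hg.aestronglyMeasurable hT).exists_seq_tendsto_ae

end L1

section SliceData

/-- **Limits of one-dimensional slice data.** Let `Mₖ, Pₖ, ETₖ, Eₖ : ℝ → ℝ` (`k ∈ ℕ`) satisfy on
`[0, L]`: `Mₖ(s) = ∫₀ˢ Pₖ`, `Mₖ ≥ 0`, `ETₖ ≥ 0`, `Pₖ² ≤ 4 Mₖ ETₖ`, `ETₖ ≤ Eₖ` a.e., with `Pₖ, ETₖ, Eₖ`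
integrable on `(0, L]` and `L¹(0,L)`-Cauchy with a modulus `βₖ + βₗ`, `β → 0`. Then there are `L¹`
limits `p, et, e` and `m = ∫₀ p` (continuous, `m(0) = 0`, `m ≥ 0`) with `|Mₖ - m| ≤ ‖Pₖ - p‖₁`
uniformly, and a.e. on `[0, L]`: `0 ≤ et ≤ e`, `p² ≤ 4 m et`. [folklore] -/
theorem exists_sliceData_limits {L : ℝ} (hL : 0 ≤ L)
    (M P ET E : ℕ → ℝ → ℝ) (β : ℕ → ℝ) (hβ : Tendsto β atTop (𝓝 0))
    (hP : ∀ k, IntegrableOn (P k) (Ioc 0 L)) (hET : ∀ k, IntegrableOn (ET k) (Ioc 0 L))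
    (hE : ∀ k, IntegrableOn (E k) (Ioc 0 L))
    (hM : ∀ k, ∀ s ∈ Icc 0 L, M k s = ∫ x in (0:ℝ)..s, P k x)
    (hM0 : ∀ k, ∀ s ∈ Icc 0 L, 0 ≤ M k s)
    (hCS : ∀ k, ∀ s ∈ Icc 0 L, 0 ≤ ET k s ∧ P k s ^ 2 ≤ 4 * M k s * ET k s)
    (hETE : ∀ k, ∀ᵐ s ∂(volume.restrict (Ioc 0 L)), ET k s ≤ E k s)
    (hcP : ∀ k l, ∫ s in Ioc 0 L, |P k s - P l s| ≤ β k + β l)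
    (hcET : ∀ k l, ∫ s in Ioc 0 L, |ET k s - ET l s| ≤ β k + β l)
    (hcE : ∀ k l, ∫ s in Ioc 0 L, |E k s - E l s| ≤ β k + β l) :
    ∃ (m p et e : ℝ → ℝ),
      ContinuousOn m (Icc 0 L) ∧ m 0 = 0 ∧ (∀ s ∈ Icc 0 L, 0 ≤ m s) ∧
      IntegrableOn p (Icc 0 L) ∧ IntegrableOn et (Icc 0 L) ∧ IntegrableOn e (Icc 0 L) ∧
      (∀ s ∈ Icc 0 L, m s = ∫ x in (0:ℝ)..s, p x) ∧
      (∀ᵐ s ∂(volume.restrict (Icc 0 L)), 0 ≤ et s ∧ et s ≤ e s ∧ p s ^ 2 ≤ 4 * m s * et s) ∧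
      Tendsto (fun k => ∫ s in Ioc 0 L, |P k s - p s|) atTop (𝓝 0) ∧
      Tendsto (fun k => ∫ s in Ioc 0 L, |ET k s - et s|) atTop (𝓝 0) ∧
      Tendsto (fun k => ∫ s in Ioc 0 L, |E k s - e s|) atTop (𝓝 0) ∧
      (∀ k, ∀ s ∈ Icc 0 L, |M k s - m s| ≤ ∫ x in Ioc 0 L, |P k x - p x|) := by
  set μ : Measure ℝ := volume.restrict (Ioc 0 L) with hμ
  -- the three `L¹` limits
  obtain ⟨p, hp, hpT⟩ := exists_integrable_tendsto_of_cauchy_modulus (μ := μ) P hP β hβ hcP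
  obtain ⟨et, het, hetT⟩ := exists_integrable_tendsto_of_cauchy_modulus (μ := μ) ET hET β hβ hcET
  obtain ⟨e, he, heT⟩ := exists_integrable_tendsto_of_cauchy_modulus (μ := μ) E hE β hβ hcE
  have hp' : IntegrableOn p (Ioc 0 L) := hp
  have het' : IntegrableOn et (Ioc 0 L) := het
  have he' : IntegrableOn e (Ioc 0 L) := he
  have hIcc : ∀ {f : ℝ → ℝ}, IntegrableOn f (Ioc 0 L) → IntegrableOn f (Icc 0 L) := fun hf =>
    (integrableOn_Icc_iff_integrableOn_Ioc' (by simp)).2 hf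
  have hpI : IntegrableOn p (Icc 0 L) := hIcc hp'
  -- the limit mass and its uniform approximation
  set m : ℝ → ℝ := fun s => ∫ x in (0:ℝ)..s, p x with hm
  have hMm : ∀ k, ∀ s ∈ Icc 0 L, |M k s - m s| ≤ ∫ x in Ioc 0 L, |P k x - p x| := by
    intro k s hs
    have hPk : IntervalIntegrable (P k) volume 0 s :=
      (intervalIntegrable_iff_integrableOn_Ioc_of_le hs.1).2 ((hP k).mono_set (Ioc_subset_Ioc_right hs.2))
    have hpk : IntervalIntegrable p volume 0 s :=
      (intervalIntegrable_iff_integrableOn_Ioc_of_le hs.1).2 (hp'.mono_set (Ioc_subset_Ioc_right hs.2))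
    rw [hM k s hs, hm]
    dsimp only
    rw [← intervalIntegral.integral_sub hPk hpk, intervalIntegral.integral_of_le hs.1]
    calc |∫ x in Ioc 0 s, P k x - p x| ≤ ∫ x in Ioc 0 s, |P k x - p x| := abs_integral_le_integral_abs
      _ ≤ ∫ x in Ioc 0 L, |P k x - p x| := by
          refine setIntegral_mono_set ((hP k).sub hp).abs ?_ (Ioc_subset_Ioc_right hs.2).eventuallyLE
          exact Eventually.of_forall fun x => abs_nonneg _
  have hMT : ∀ s ∈ Icc 0 L, Tendsto (fun k => M k s) atTop (𝓝 (m s)) := by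
    intro s hs
    refine tendsto_iff_norm_sub_tendsto_zero.2 ?_
    refine squeeze_zero (fun k => norm_nonneg _) (fun k => ?_) hpT
    rw [Real.norm_eq_abs]
    exact hMm k s hs
  have hm0 : ∀ s ∈ Icc 0 L, 0 ≤ m s := fun s hs =>
    ge_of_tendsto' (hMT s hs) fun k => hM0 k s hs
  -- an a.e. convergent subsequence for the three data at once
  set h : ℕ → ℝ → ℝ := fun k s => |P k s - p s| + |ET k s - et s| + |E k s - e s| with hh
  have hhi : ∀ k, Integrable (h k) μ := fun k =>
    (((hP k).sub hp).abs.add ((hET k).sub het).abs).add ((hE k).sub he).abs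
  have hhT : Tendsto (fun k => ∫ s, |h k s - (0 : ℝ → ℝ) s| ∂μ) atTop (𝓝 0) := by
    have h3 := (hpT.add hetT).add heT
    rw [add_zero, add_zero] at h3
    refine h3.congr fun k => ?_
    have habs : (fun s => |h k s - (0 : ℝ → ℝ) s|) =
        fun s => (|P k s - p s| + |ET k s - et s|) + |E k s - e s| := by
      funext s
      simp only [hh, Pi.zero_apply, sub_zero]
      exact abs_of_nonneg (by positivity)
    have i1 : Integrable (fun s => |P k s - p s|) μ := ((hP k).sub hp).abs
    have i2 : Integrable (fun s => |ET k s - et s|) μ := ((hET k).sub het).abs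
    have i3 : Integrable (fun s => |E k s - e s|) μ := ((hE k).sub he).abs
    have i12 : Integrable (fun s => |P k s - p s| + |ET k s - et s|) μ := i1.add i2
    rw [habs, integral_add i12 i3, integral_add i1 i2]
  obtain ⟨ns, hns, hae⟩ := exists_subseq_ae_tendsto_of_L1 (μ := μ) h 0 hhi (integrable_zero _ _ _) hhT
  have hETE' : ∀ᵐ s ∂μ, ∀ k, ET k s ≤ E k s := ae_all_iff.2 hETE
  have hmem : ∀ᵐ s ∂μ, s ∈ Ioc 0 L := ae_restrict_mem measurableSet_Ioc
  have hae' : ∀ᵐ s ∂μ, 0 ≤ et s ∧ et s ≤ e s ∧ p s ^ 2 ≤ 4 * m s * et s := by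
    filter_upwards [hae, hETE', hmem] with s hs hs2 hs3
    have hsI : s ∈ Icc 0 L := Ioc_subset_Icc_self hs3
    simp only [Pi.zero_apply] at hs
    -- each of the three differences tends to zero along `ns`
    have hb : ∀ {u : ℕ → ℝ}, (∀ j, |u j| ≤ h (ns j) s) → Tendsto u atTop (𝓝 0) := fun hu =>
      squeeze_zero_norm (fun j => by rw [Real.norm_eq_abs]; exact hu j) hs
    have h1 : Tendsto (fun j => P (ns j) s) atTop (𝓝 (p s)) := by
      refine tendsto_iff_norm_sub_tendsto_zero.2 (hb fun j => ?_)
      rw [hh]; dsimp only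
      have := abs_nonneg (ET (ns j) s - et s); have := abs_nonneg (E (ns j) s - e s)
      rw [Real.norm_eq_abs, abs_abs]; linarith
    have h2 : Tendsto (fun j => ET (ns j) s) atTop (𝓝 (et s)) := by
      refine tendsto_iff_norm_sub_tendsto_zero.2 (hb fun j => ?_)
      rw [hh]; dsimp only
      have := abs_nonneg (P (ns j) s - p s); have := abs_nonneg (E (ns j) s - e s)
      rw [Real.norm_eq_abs, abs_abs]; linarith
    have h3 : Tendsto (fun j => E (ns j) s) atTop (𝓝 (e s)) := by
      refine tendsto_iff_norm_sub_tendsto_zero.2 (hb fun j => ?_)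
      rw [hh]; dsimp only
      have := abs_nonneg (P (ns j) s - p s); have := abs_nonneg (ET (ns j) s - et s)
      rw [Real.norm_eq_abs, abs_abs]; linarith
    have h4 : Tendsto (fun j => M (ns j) s) atTop (𝓝 (m s)) := (hMT s hsI).comp hns.tendsto_atTop
    refine ⟨ge_of_tendsto' h2 fun j => (hCS (ns j) s hsI).1,
      le_of_tendsto_of_tendsto' h2 h3 fun j => hs2 (ns j), ?_⟩
    exact le_of_tendsto_of_tendsto' (h1.pow 2) ((h4.const_mul 4).mul h2)
      fun j => (hCS (ns j) s hsI).2
  refine ⟨m, p, et, e, ?_, ?_, hm0, hpI, hIcc het', hIcc he', fun s _ => rfl, ?_, hpT, hetT, heT, hMm⟩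
  · have := intervalIntegral.continuousOn_primitive_interval (μ := volume) (a := 0) (b := L)
      (by rw [uIcc_of_le hL]; exact hpI)
    rw [uIcc_of_le hL] at this
    exact this
  · simp [hm]
  · have hcongr : (volume.restrict (Icc 0 L) : Measure ℝ) = μ :=
      (Measure.restrict_congr_set Ioc_ae_eq_Icc).symm
    rw [hcongr]
    exact hae'

end SliceData

end Literature.Analysis.FunctionSpaces

end
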